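import Mathlib
import Literature.NumberTheory.LFunctions.KloostermanQuadraticTwist
import Literature.NumberTheory.GaussSums.KloostermanTwistedMoment
import HarnessLib

/-!
# Kunisky–Yu 2022, Theorem 4.22: the character sum `∑_{x,y} χ(x(x+1)y(y+1)) φ(x − y)` is `O(p)` — PROVED

Topic `Literature/Combinatorics/SimpleGraph` (support for the Paley SOS fact
`kuniskyYu2022_theorem_1_2`).  For an odd prime `p`, `χ` the quadratic character of `𝔽_p` and
ANY multiplicative character `φ` (with `φ(0) = 0`),

  `|∑_{x,y ∈ 𝔽_p} χ(x(x+1)) χ(y(y+1)) φ(x − y)| ≤ 2p`     (`norm_paleyFourPointSum_le`).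

This is Kunisky–Yu's Theorem 4.22 ("`≤ 2p`" for every `φ`; they treat `φ = 1` separately, where
the sum is `1 − (p − 2)`), and it controls the eigenvalues of the zero-frequency (translation
invariant) block of the graph matrix `T^{4,4,1}` of the Paley graph (their (138)).  Proof, following
Kunisky–Yu §4.7.2 but with the input [Liu02] replaced by the tree's ELEMENTARY evaluation
(`Literature.NumberTheory.GaussSums.norm_sum_mulChar_mul_kloostermanSum_sq_sq_le`):
for `φ ≠ 1`, insert `φ(w) g(φ⁻¹) = ∑_a φ⁻¹(a) e(aw)`; the sums over `x` and `y` become the Fourier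
transforms `∑_x χ(x(x+1)) e(±ax) = e(∓a/2) K((a/4)²)` (Kloosterman sums at squares,
`sum_quadraticChar_mul_sub_mul_stdAddChar`), so `g(φ⁻¹) Λ(φ) = φ⁻¹(4) ∑_b φ⁻¹(b) K(b²)²`, of
modulus `≤ 2p^{3/2}`, and `|g| = √p`.  Also the re-indexing to the kernel form used by the
dilation argument (`paleyKernel_eigenvalue_eq`, `norm_paleyKernel_eigenvalue_le`).

## References

* D. Kunisky, X. Yu, arXiv:2211.02713 (2022), Theorem 4.22, (134)–(138).  [KuniskyYu2022]
* J. B. Conrey, H. Iwaniec, Ann. of Math. 151 (2000), §14 (the case `φ = χ`).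
-/

noncomputable section

open Finset
open Literature.NumberTheory.LFunctions
open Literature.NumberTheory.GaussSums
open Literature.NumberTheory.Sieve.FriedlanderIwaniecPrimes

namespace Literature.Combinatorics.SimpleGraph

section CharSum

variable {p : ℕ} [hp : Fact p.Prime]

/-- The Fourier transform of `x ↦ χ(x(x+1))`: `∑_x χ(x(x+1)) e(rx/p) = e(−r/2p) K((r/4)²)`
(Kunisky–Yu (129) with `i ↦ −1`; `K = S(1, ·; p)`). [cite: KuniskyYu2022, Proposition 4.11] -/
theorem sum_quadraticChar_mul_add_one_mul_stdAddChar (hp2 : p ≠ 2) (r : ZMod p) :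
    ∑ x : ZMod p, ((quadraticChar (ZMod p) (x * (x + 1)) : ℤ) : ℂ) * ZMod.stdAddChar (r * x) =
      ZMod.stdAddChar (-r / 2) * kloostermanSum p 1 ((r / 4) ^ 2) := by
  have hm1 : (-1 : ZMod p) ≠ 0 := neg_ne_zero.mpr one_ne_zero
  have h := sum_quadraticChar_mul_sub_mul_stdAddChar hp2 hm1 r
  simp only [sub_neg_eq_add] at h
  rw [h]
  congr 2
  · ring
  · ring

/-- **Kunisky–Yu 2022, Theorem 4.22**, non-trivial twist: for `φ ≠ 1`,
`|∑_{x,y} χ(x(x+1)) χ(y(y+1)) φ(x − y)| ≤ 2p`.  (Gauss sum insertion, Fourier transforms to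
Kloosterman sums at squares, and the elementary twisted-moment bound
`|∑_b φ⁻¹(b) K(b²)²| ≤ 2p^{3/2}`.) [cite: KuniskyYu2022, Theorem 4.22] -/
theorem norm_paleyFourPointSum_le_of_ne_one (hp2 : p ≠ 2) {φ : MulChar (ZMod p) ℂ}
    (hφ : φ ≠ 1) :
    ‖∑ x : ZMod p, ∑ y : ZMod p, ((quadraticChar (ZMod p) (x * (x + 1)) : ℤ) : ℂ) *
        ((quadraticChar (ZMod p) (y * (y + 1)) : ℤ) : ℂ) * φ (x - y)‖ ≤ 2 * p := by
  classical
  have hF : ringChar (ZMod p) ≠ 2 := by rwa [ZMod.ringChar_zmod_n]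
  have h2 : (2 : ZMod p) ≠ 0 := Ring.two_ne_zero hF
  have h4 : (4 : ZMod p) ≠ 0 := by
    have : (4 : ZMod p) = 2 * 2 := by norm_num
    rw [this]; exact mul_ne_zero h2 h2
  have hφi : φ⁻¹ ≠ 1 := fun h => hφ (inv_eq_one.mp h)
  set G : ℂ := gaussSum φ⁻¹ (ZMod.stdAddChar (N := p)) with hG
  have hGnorm : ‖G‖ = Real.sqrt p := norm_gaussSum_stdAddChar hφi
  have hp0 : (0 : ℝ) < p := by exact_mod_cast hp.out.pos
  have hGpos : 0 < ‖G‖ := by rw [hGnorm]; exact Real.sqrt_pos.mpr hp0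
  set h : ZMod p → ℂ := fun x => ((quadraticChar (ZMod p) (x * (x + 1)) : ℤ) : ℂ) with hh
  set Λ : ℂ := ∑ x : ZMod p, ∑ y : ZMod p, h x * h y * φ (x - y) with hΛ
  -- Step 1: Gauss sum insertion `φ(w) G = ∑_a φ⁻¹(a) e(aw)`
  have hins : ∀ w : ZMod p, φ w * G = ∑ a : ZMod p, φ⁻¹ a * ZMod.stdAddChar (a * w) := by
    intro w
    rw [sum_mulChar_mul_stdAddChar_mul hφi w, inv_inv]
  -- Step 2: `G Λ = ∑_a φ⁻¹(a) H(a) H(-a)`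
  have h3 : ∀ x y : ZMod p, h x * h y * φ (x - y) * G =
      ∑ a : ZMod p, φ⁻¹ a * (h x * ZMod.stdAddChar (a * x) * (h y * ZMod.stdAddChar (-a * y))) := by
    intro x y
    rw [mul_assoc, hins (x - y), Finset.mul_sum]
    refine Finset.sum_congr rfl fun a _ => ?_
    have he : (ZMod.stdAddChar (a * (x - y)) : ℂ) =
        ZMod.stdAddChar (a * x) * ZMod.stdAddChar (-a * y) := by
      rw [← AddChar.map_add_eq_mul]
      congr 1
      ring
    rw [he]
    ring
  have hL : Λ * G = ∑ a : ZMod p, ∑ x : ZMod p, ∑ y : ZMod p,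
      φ⁻¹ a * (h x * ZMod.stdAddChar (a * x) * (h y * ZMod.stdAddChar (-a * y))) := by
    rw [hΛ, Finset.sum_mul]
    have h5 : ∀ x : ZMod p, (∑ y : ZMod p, h x * h y * φ (x - y)) * G =
        ∑ y : ZMod p, ∑ a : ZMod p,
          φ⁻¹ a * (h x * ZMod.stdAddChar (a * x) * (h y * ZMod.stdAddChar (-a * y))) := by
      intro x
      rw [Finset.sum_mul]
      exact Finset.sum_congr rfl fun y _ => h3 x y
    simp_rw [h5]
    exact (Finset.sum_congr rfl fun x _ => Finset.sum_comm).trans Finset.sum_comm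
  have hstep2 : Λ * G = ∑ a : ZMod p, φ⁻¹ a *
      ((∑ x : ZMod p, h x * ZMod.stdAddChar (a * x)) *
        (∑ y : ZMod p, h y * ZMod.stdAddChar (-a * y))) := by
    rw [hL]
    refine Finset.sum_congr rfl fun a _ => ?_
    rw [Finset.sum_mul_sum, Finset.mul_sum]
    refine Finset.sum_congr rfl fun x _ => ?_
    rw [Finset.mul_sum]
  -- Step 3: the Fourier transforms are Kloosterman sums at squares
  have hH : ∀ a : ZMod p, (∑ x : ZMod p, h x * ZMod.stdAddChar (a * x)) *
      (∑ y : ZMod p, h y * ZMod.stdAddChar (-a * y)) = kloostermanSum p 1 ((a / 4) ^ 2) ^ 2 := by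
    intro a
    rw [hh]
    simp only
    rw [sum_quadraticChar_mul_add_one_mul_stdAddChar hp2 a,
      sum_quadraticChar_mul_add_one_mul_stdAddChar hp2 (-a)]
    have hsq : ((-a) / 4) ^ 2 = (a / 4) ^ 2 := by ring
    rw [hsq, neg_neg]
    have he : (ZMod.stdAddChar (-a / 2) : ℂ) * ZMod.stdAddChar (a / 2) = 1 := by
      rw [← AddChar.map_add_eq_mul, show -a / 2 + a / 2 = (0 : ZMod p) by ring,
        AddChar.map_zero_eq_one]
    calc (ZMod.stdAddChar (-a / 2) : ℂ) * kloostermanSum p 1 ((a / 4) ^ 2) *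
          (ZMod.stdAddChar (a / 2) * kloostermanSum p 1 ((a / 4) ^ 2))
        = (ZMod.stdAddChar (-a / 2) * ZMod.stdAddChar (a / 2)) *
            kloostermanSum p 1 ((a / 4) ^ 2) ^ 2 := by ring
      _ = kloostermanSum p 1 ((a / 4) ^ 2) ^ 2 := by rw [he, one_mul]
  simp_rw [hH] at hstep2
  -- Step 4: substitute `a = 4b`
  have hstep4 : ∑ a : ZMod p, φ⁻¹ a * kloostermanSum p 1 ((a / 4) ^ 2) ^ 2 =
      φ⁻¹ 4 * ∑ b : ZMod p, φ⁻¹ b * kloostermanSum p 1 (b ^ 2) ^ 2 := by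
    rw [Finset.mul_sum]
    refine (Fintype.sum_bijective ((4 : ZMod p) * ·) (mulLeft_bijective₀ 4 h4) _ _
      fun b => ?_).symm
    show φ⁻¹ 4 * (φ⁻¹ b * kloostermanSum p 1 (b ^ 2) ^ 2) =
      φ⁻¹ (4 * b) * kloostermanSum p 1 ((4 * b / 4) ^ 2) ^ 2
    rw [map_mul, mul_div_cancel_left₀ b h4]
    ring
  rw [hstep4] at hstep2
  -- Step 5: norms
  have hbound := norm_sum_mulChar_mul_kloostermanSum_sq_sq_le hp2 hφi
  have hn : ‖Λ‖ * ‖G‖ ≤ 2 * ((p : ℝ) * Real.sqrt p) := by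
    rw [← norm_mul, hstep2, norm_mul]
    calc ‖φ⁻¹ 4‖ * ‖∑ b : ZMod p, φ⁻¹ b * kloostermanSum p 1 (b ^ 2) ^ 2‖
        ≤ 1 * (2 * ((p : ℝ) * Real.sqrt p)) :=
          mul_le_mul (norm_mulChar_apply_le_one _ _) hbound (norm_nonneg _) zero_le_one
      _ = 2 * ((p : ℝ) * Real.sqrt p) := one_mul _
  rw [hGnorm] at hn
  have hs : 0 < Real.sqrt p := Real.sqrt_pos.mpr hp0
  have : ‖Λ‖ ≤ 2 * p := by
    have h' : ‖Λ‖ * Real.sqrt p ≤ (2 * p) * Real.sqrt p := by nlinarith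
    exact le_of_mul_le_mul_right h' hs
  exact this

/-- **Kunisky–Yu 2022, Theorem 4.22**, trivial twist (their (135)): for `φ = 1` the sum is
`1 − ∑_x χ(x(x+1))²` (`= 3 − p`), of modulus `≤ 1 + p ≤ 2p`. [cite: KuniskyYu2022, Theorem 4.22] -/
theorem norm_paleyFourPointSum_one_le (hp2 : p ≠ 2) :
    ‖∑ x : ZMod p, ∑ y : ZMod p, ((quadraticChar (ZMod p) (x * (x + 1)) : ℤ) : ℂ) *
        ((quadraticChar (ZMod p) (y * (y + 1)) : ℤ) : ℂ) * (1 : MulChar (ZMod p) ℂ) (x - y)‖ ≤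
      2 * p := by
  classical
  set h : ZMod p → ℂ := fun x => ((quadraticChar (ZMod p) (x * (x + 1)) : ℤ) : ℂ) with hh
  have hm1 : (-1 : ZMod p) ≠ 0 := neg_ne_zero.mpr one_ne_zero
  have hsum : ∑ y : ZMod p, h y = -1 := by
    have := sum_quadraticChar_mul_sub_eq_neg_one hp2 hm1
    simp only [sub_neg_eq_add] at this
    rw [hh]
    exact this
  -- inner sum: `∑_y h(y) 1(x - y) = -1 - h(x)`
  have hinner : ∀ x : ZMod p, ∑ y : ZMod p, h x * h y * (1 : MulChar (ZMod p) ℂ) (x - y) =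
      h x * (-1 - h x) := by
    intro x
    have h1 : ∀ y : ZMod p, h x * h y * (1 : MulChar (ZMod p) ℂ) (x - y) =
        h x * h y - if y = x then h x * h x else 0 := by
      intro y
      by_cases hxy : x = y
      · rw [hxy, sub_self, MulChar.map_zero, if_pos rfl]; ring
      · rw [MulChar.one_apply (isUnit_iff_ne_zero.mpr (sub_ne_zero.mpr hxy)),
          if_neg (Ne.symm hxy)]; ring
    simp_rw [h1]
    rw [Finset.sum_sub_distrib, Finset.sum_ite_eq' Finset.univ x, if_pos (Finset.mem_univ x),
      ← Finset.mul_sum, hsum]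
    ring
  have hΛ : ∑ x : ZMod p, ∑ y : ZMod p, h x * h y * (1 : MulChar (ZMod p) ℂ) (x - y) =
      1 - ∑ x : ZMod p, h x * h x := by
    simp_rw [hinner]
    have : ∀ x : ZMod p, h x * (-1 - h x) = -h x - h x * h x := fun x => by ring
    simp_rw [this]
    rw [Finset.sum_sub_distrib, Finset.sum_neg_distrib, hsum]
    ring
  change ‖∑ x : ZMod p, ∑ y : ZMod p, h x * h y * (1 : MulChar (ZMod p) ℂ) (x - y)‖ ≤ 2 * p
  rw [hΛ]
  have hb : ‖∑ x : ZMod p, h x * h x‖ ≤ p := by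
    calc ‖∑ x : ZMod p, h x * h x‖ ≤ ∑ x : ZMod p, ‖h x * h x‖ := norm_sum_le _ _
      _ ≤ ∑ _x : ZMod p, (1 : ℝ) := Finset.sum_le_sum fun x _ => by
          rw [norm_mul, hh]
          have : ‖((quadraticChar (ZMod p) (x * (x + 1)) : ℤ) : ℂ)‖ ≤ 1 := by
            by_cases ha : x * (x + 1) = 0
            · rw [ha, MulChar.map_zero, Int.cast_zero, norm_zero]
              exact zero_le_one
            · rcases quadraticChar_dichotomy ha with h | h <;> rw [h] <;> simp
          have h0 := norm_nonneg (((quadraticChar (ZMod p) (x * (x + 1)) : ℤ) : ℂ))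
          nlinarith
      _ = p := by simp
  have hp1 : (1 : ℝ) ≤ p := by exact_mod_cast hp.out.one_lt.le
  calc ‖(1 : ℂ) - ∑ x : ZMod p, h x * h x‖ ≤ ‖(1 : ℂ)‖ + ‖∑ x : ZMod p, h x * h x‖ :=
        norm_sub_le _ _
    _ ≤ 1 + p := by rw [norm_one]; linarith
    _ ≤ 2 * p := by linarith

/-- **Kunisky–Yu 2022, Theorem 4.22** (as printed: "For any multiplicative character `φ` of `𝔽_p`,
`|∑_{x,y} χ(x(x+1)(x−y)((x+1)−y)) φ(y)| = |∑_{x,y} χ(x(x+1)y(y+1)) φ(x−y)| ≤ 2p`"), in the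
second form, for an odd prime `p`. [cite: KuniskyYu2022, Theorem 4.22] -/
theorem norm_paleyFourPointSum_le (hp2 : p ≠ 2) (φ : MulChar (ZMod p) ℂ) :
    ‖∑ x : ZMod p, ∑ y : ZMod p, ((quadraticChar (ZMod p) (x * (x + 1)) : ℤ) : ℂ) *
        ((quadraticChar (ZMod p) (y * (y + 1)) : ℤ) : ℂ) * φ (x - y)‖ ≤ 2 * p := by
  by_cases hφ : φ = 1
  · subst hφ
    exact norm_paleyFourPointSum_one_le hp2
  · exact norm_paleyFourPointSum_le_of_ne_one hp2 hφ

/-- Re-indexing the eigenvalue of the zero-frequency Paley kernel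
`f(λ) = ∑_u χ(u) χ(u − λ) χ(u + 1) χ(u + 1 − λ)` against a character:
`∑_λ f(λ) φ(λ) = ∑_{x,y} χ(x(x+1)) χ(y(y+1)) φ(x − y)` (`y = u − λ`).
[cite: KuniskyYu2022, §4.7.3 (138)] -/
theorem paleyKernel_eigenvalue_eq (φ : MulChar (ZMod p) ℂ) :
    ∑ l : ZMod p, (∑ u : ZMod p, ((quadraticChar (ZMod p) u : ℤ) : ℂ) *
        ((quadraticChar (ZMod p) (u - l) : ℤ) : ℂ) * ((quadraticChar (ZMod p) (u + 1) : ℤ) : ℂ) *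
        ((quadraticChar (ZMod p) (u + 1 - l) : ℤ) : ℂ)) * φ l =
      ∑ x : ZMod p, ∑ y : ZMod p, ((quadraticChar (ZMod p) (x * (x + 1)) : ℤ) : ℂ) *
        ((quadraticChar (ZMod p) (y * (y + 1)) : ℤ) : ℂ) * φ (x - y) := by
  simp_rw [Finset.sum_mul]
  rw [Finset.sum_comm]
  refine Finset.sum_congr rfl fun u _ => ?_
  refine Fintype.sum_equiv (Equiv.subLeft u) _ _ fun l => ?_
  simp only [Equiv.subLeft_apply]
  have e1 : u + 1 - l = u - l + 1 := by ring
  have e2 : u - (u - l) = l := by ring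
  rw [e1, e2, map_mul, map_mul]
  push_cast
  ring

/-- **Eigenvalue bound for the zero-frequency Paley kernel**: for every multiplicative
character `φ`, `|∑_λ f(λ) φ(λ)| ≤ 2p`. [cite: KuniskyYu2022, Theorem 4.22] -/
theorem norm_paleyKernel_eigenvalue_le (hp2 : p ≠ 2) (φ : MulChar (ZMod p) ℂ) :
    ‖∑ l : ZMod p, (∑ u : ZMod p, ((quadraticChar (ZMod p) u : ℤ) : ℂ) *
        ((quadraticChar (ZMod p) (u - l) : ℤ) : ℂ) * ((quadraticChar (ZMod p) (u + 1) : ℤ) : ℂ) *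
        ((quadraticChar (ZMod p) (u + 1 - l) : ℤ) : ℂ)) * φ l‖ ≤ 2 * p := by
  rw [paleyKernel_eigenvalue_eq]
  exact norm_paleyFourPointSum_le hp2 φ

end CharSum

end Literature.Combinatorics.SimpleGraph

end
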